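import Mathlib
import Literature.Barriers.ValiantsHypothesis.TauRealZeros

/-!
PLACEMENT NOTE. NEGATIVE knowledge in the Literature (τ) currency, homed under `Theorems/MatrixDescartes/Negative/`:
the filer is a planner seat (val-idea-13 g1) banking its kernel workfile `Cruxes/MatrixDescartes/Lines/hexadecade.lean`
(§ sector, § W-TOWER; texts verbatim, two files at the natural seam per director ruling g12-R159 (e)) after critic
val-idea-crit-4's by-name PASS (VERDICT #7); the crux `MatrixDescartes` (`stmt-ValiantsHypothesis-18050`) is NOT
touched; a prover may re-home these files verbatim to flat `LacunarySymmetroidMatrixDescartesHexadecade*.lean` names.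
VP ≠ VNP is not moved; no summit statement is proved here.

# The hexadecadal sector (file 1 of 2): definition, IVT root count, and the candidate τ-bound it does NOT satisfy

Extends `Literature.…TauRealZeros` / `not_separatedRealZeroTauBound` from metric to geometric (ratio-16) separation;
witness family W_k = Joukowski-conjugated doubling tower (val-idea-crit-4 certificate 2026-08-28, typed and
kernel-checked by val-idea-13 g1); folklore mechanism (Chebyshev/Dickson doubling), new only in the separation
bookkeeping.

* `AlternatesGP r N p` / `IsHexadecadal p` — the sector: `natDegree p` sign flips along a ratio-`16` geometric
  progression; `exists_roots_of_alternatesGP`, `card_roots_eq_natDegree_of_isHexadecadal` (IVT: real-rooted, simple,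
  one root per hexadecade, all of the sign of the base point).
* `HexRealZeroTauBound c` — the candidate sector bound «#real roots ≤ (τ(f)+2)^c for hexadecadal `f ∈ ℤ[X]`»
  (`τ` = the tree's `constantFreeComplexity`): FALSE — refuted in file 2 (`HexadecadeWTower`:
  `WTower.not_hexRealZeroTauBound_one`, and for every `c` given the all-level grid signs);
  `hexRealZeroTauBound_of_realZeroTauBound` places it under the tree's refuted `RealZeroTauBound`.

[folklore] IVT root counting along a geometric progression.
-/

set_option linter.dupNamespace false

noncomputable section

namespace Summit.ValiantsHypothesis.ValiantsHypothesis.Theorems.LacunarySymmetroidMatrixDescartes.Hexadecade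

open scoped BigOperators Polynomial
open Polynomial
open Literature.Computability.AlgebraicComplexity
open Literature.Barriers.ValiantsHypothesis (RealZeroTauBound)

/-! ## The sector: sign alternation along a geometric progression -/

/-- `p` changes sign between any two consecutive points of the geometric progression
`x₀, x₀ r, …, x₀ r^N` (`N` sign flips read off `N + 1` explicit sample points). -/
def AlternatesGP (r : ℝ) (N : ℕ) (p : ℝ[X]) : Prop :=
  ∃ x₀ : ℝ, x₀ ≠ 0 ∧ ∀ k : ℕ, k < N → p.eval (x₀ * r ^ k) * p.eval (x₀ * r ^ (k + 1)) < 0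

/-- **The hexadecadal sector**: `p` flips sign `natDegree p` times along some ratio-`16` geometric progression
(hence all roots real and simple — `card_roots_eq_natDegree_of_isHexadecadal` — one per hexadecade). -/
def IsHexadecadal (p : ℝ[X]) : Prop := AlternatesGP 16 p.natDegree p

/-! ## Sign flips along a geometric progression give one-signed roots, one per step -/

/-- IVT between two points where `p` takes values of opposite signs. -/
theorem exists_root_Ioo_of_mul_neg (p : ℝ[X]) {a b : ℝ} (hab : a < b)
    (h : p.eval a * p.eval b < 0) : ∃ c, a < c ∧ c < b ∧ p.IsRoot c := by
  have hcont := p.continuousOn (s := Set.Icc a b)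
  rcases mul_neg_iff.1 h with ⟨ha, hb⟩ | ⟨ha, hb⟩
  · obtain ⟨c, hc, hc0⟩ := intermediate_value_Ioo' hab.le hcont ⟨hb, ha⟩
    exact ⟨c, hc.1, hc.2, hc0⟩
  · obtain ⟨c, hc, hc0⟩ := intermediate_value_Ioo hab.le hcont ⟨ha, hb⟩
    exact ⟨c, hc.1, hc.2, hc0⟩

/-- **`N` flips along a ratio-`r` progression (`r > 1`) give `N` distinct roots of the sign of `x₀`.** -/
theorem exists_roots_of_alternatesGP {r : ℝ} (hr : 1 < r) {N : ℕ} {p : ℝ[X]}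
    (h : AlternatesGP r N p) :
    ∃ x₀ : ℝ, x₀ ≠ 0 ∧ ∃ T : Finset ℝ, T ⊆ p.roots.toFinset ∧ T.card = N ∧ ∀ t ∈ T, 0 < x₀ * t := by
  classical
  obtain ⟨x₀, hx0, hs⟩ := h
  refine ⟨x₀, hx0, ?_⟩
  have hp : ∀ k, k < N → p ≠ 0 := by
    intro k hk hp0
    have := hs k hk
    rw [hp0, eval_zero, zero_mul] at this
    exact lt_irrefl _ this
  have hr0 : 0 < r := by linarith
  have hpow : ∀ k : ℕ, r ^ k < r ^ (k + 1) := fun k => pow_lt_pow_right₀ hr (Nat.lt_succ_self k)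
  have hmono : ∀ {k k' : ℕ}, k ≤ k' → r ^ k ≤ r ^ k' := fun hkk' => pow_le_pow_right₀ hr.le hkk'
  rcases lt_or_gt_of_ne hx0 with hneg | hpos
  · -- `x₀ < 0`: the points decrease
    have hlt : ∀ k, x₀ * r ^ (k + 1) < x₀ * r ^ k := fun k => mul_lt_mul_of_neg_left (hpow k) hneg
    have hroot : ∀ k, k < N → ∃ c, x₀ * r ^ (k + 1) < c ∧ c < x₀ * r ^ k ∧ p.IsRoot c := by
      intro k hk
      exact exists_root_Ioo_of_mul_neg p (hlt k) (by rw [mul_comm]; exact hs k hk)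
    choose! c hc using hroot
    have hinj : Set.InjOn c (Finset.range N : Set ℕ) := by
      intro k hk k' hk' hkk
      have hkN : k < N := by simpa using hk
      have hkN' : k' < N := by simpa using hk'
      by_contra hne
      rcases lt_or_gt_of_ne hne with hlt' | hlt'
      · have h1 : x₀ * r ^ k' ≤ x₀ * r ^ (k + 1) :=
          mul_le_mul_of_nonpos_left (hmono (by omega)) hneg.le
        have h2 := (hc k hkN).1
        have h3 := (hc k' hkN').2.1
        linarith
      · have h1 : x₀ * r ^ k ≤ x₀ * r ^ (k' + 1) :=
          mul_le_mul_of_nonpos_left (hmono (by omega)) hneg.le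
        have h2 := (hc k' hkN').1
        have h3 := (hc k hkN).2.1
        linarith
    refine ⟨(Finset.range N).image c, ?_, ?_, ?_⟩
    · intro t ht
      obtain ⟨k, hk, rfl⟩ := Finset.mem_image.1 ht
      have hk' : k < N := Finset.mem_range.1 hk
      rw [Multiset.mem_toFinset, mem_roots (hp k hk')]
      exact (hc k hk').2.2
    · rw [Finset.card_image_of_injOn hinj, Finset.card_range]
    · intro t ht
      obtain ⟨k, hk, rfl⟩ := Finset.mem_image.1 ht
      have hk' : k < N := Finset.mem_range.1 hk
      have h1 : c k < x₀ * r ^ k := (hc k hk').2.1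
      have h2 : x₀ * r ^ k < 0 := mul_neg_of_neg_of_pos hneg (pow_pos hr0 k)
      exact mul_pos_of_neg_of_neg hneg (h1.trans h2)
  · -- `0 < x₀`: the points increase
    have hlt : ∀ k, x₀ * r ^ k < x₀ * r ^ (k + 1) := fun k => mul_lt_mul_of_pos_left (hpow k) hpos
    have hroot : ∀ k, k < N → ∃ c, x₀ * r ^ k < c ∧ c < x₀ * r ^ (k + 1) ∧ p.IsRoot c := by
      intro k hk
      exact exists_root_Ioo_of_mul_neg p (hlt k) (hs k hk)
    choose! c hc using hroot
    have hinj : Set.InjOn c (Finset.range N : Set ℕ) := by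
      intro k hk k' hk' hkk
      have hkN : k < N := by simpa using hk
      have hkN' : k' < N := by simpa using hk'
      by_contra hne
      rcases lt_or_gt_of_ne hne with hlt' | hlt'
      · have h1 : x₀ * r ^ (k + 1) ≤ x₀ * r ^ k' :=
          mul_le_mul_of_nonneg_left (hmono (by omega)) hpos.le
        have h2 := (hc k hkN).2.1
        have h3 := (hc k' hkN').1
        linarith
      · have h1 : x₀ * r ^ (k' + 1) ≤ x₀ * r ^ k :=
          mul_le_mul_of_nonneg_left (hmono (by omega)) hpos.le
        have h2 := (hc k' hkN').2.1
        have h3 := (hc k hkN).1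
        linarith
    refine ⟨(Finset.range N).image c, ?_, ?_, ?_⟩
    · intro t ht
      obtain ⟨k, hk, rfl⟩ := Finset.mem_image.1 ht
      have hk' : k < N := Finset.mem_range.1 hk
      rw [Multiset.mem_toFinset, mem_roots (hp k hk')]
      exact (hc k hk').2.2
    · rw [Finset.card_image_of_injOn hinj, Finset.card_range]
    · intro t ht
      obtain ⟨k, hk, rfl⟩ := Finset.mem_image.1 ht
      have hk' : k < N := Finset.mem_range.1 hk
      have h1 : x₀ * r ^ k < c k := (hc k hk').1
      have h2 : 0 < x₀ * r ^ k := mul_pos hpos (pow_pos hr0 k)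
      exact mul_pos hpos (h2.trans h1)

/-- `N` flips along a ratio-`r` progression force `N` distinct real roots. -/
theorem le_card_roots_of_alternatesGP {r : ℝ} (hr : 1 < r) {N : ℕ} {p : ℝ[X]}
    (h : AlternatesGP r N p) : N ≤ p.roots.toFinset.card := by
  obtain ⟨x₀, -, T, hT, hcard, -⟩ := exists_roots_of_alternatesGP hr h
  rw [← hcard]
  exact Finset.card_le_card hT

/-- Hexadecadal ⇒ real-rooted with simple roots (the sector sits INSIDE the sector of LINE «hyperbolic»). -/
theorem card_roots_eq_natDegree_of_isHexadecadal {p : ℝ[X]} (h : IsHexadecadal p) :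
    p.roots.toFinset.card = p.natDegree :=
  le_antisymm ((Multiset.toFinset_card_le _).trans (card_roots' p))
    (le_card_roots_of_alternatesGP (by norm_num) h)

/-! ## The candidate sector bound (FALSE) -/

/-- **Candidate sector bound — FALSE, see `WTower.not_hexRealZeroTauBound_one` (file `HexadecadeWTower`)**: the
τ-bound on REAL zeros restricted to hexadecadal integer polynomials (`τ` = the tree's `constantFreeComplexity`,
distinct real roots counted). -/
def HexRealZeroTauBound (c : ℕ) : Prop :=
  ∀ f : Polynomial ℤ, f ≠ 0 → IsHexadecadal (f.map (Int.castRingHom ℝ)) →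
    (f.map (Int.castRingHom ℝ)).roots.toFinset.card ≤
      (constantFreeComplexity ((MvPolynomial.uniqueAlgEquiv ℤ (Fin 1)).symm f) + 2) ^ c

/-- The tree's refuted class `RealZeroTauBound` implies the restricted one (both are FALSE). -/
theorem hexRealZeroTauBound_of_realZeroTauBound {c : ℕ} (h : RealZeroTauBound c) :
    HexRealZeroTauBound c := fun f hf _ => h f hf

end Summit.ValiantsHypothesis.ValiantsHypothesis.Theorems.LacunarySymmetroidMatrixDescartes.Hexadecade
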